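import Literature.Algebra.Homology.FlatQuasiIsoBaseChange
import Mathlib.Algebra.Homology.ShortComplex.Ab
import HarnessLib

/-!
# An elementwise criterion for quasi-isomorphisms of complexes of abelian groups

The `Ab`-valued twin of `Literature.Algebra.Homology.quasiIso_of_surj_inj`
(`Algebra/Homology/FiniteFreeResolution`, stated there for `ModuleCat R`): a morphism `φ : F → C` of
`ℤ`-indexed cochain complexes of abelian groups is a quasi-isomorphism as soon as, elementwise, every cocycle
of `C` is `φ` of a cocycle of `F` up to a coboundary, and every cocycle of `F` whose image is a coboundary is a
coboundary. The proof is the same: the mapping cone is then acyclic (`quasiIso_iff_acyclic_mappingCone`,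
`Algebra/Homology/FlatQuasiIsoBaseChange`, valid in any abelian category), made elementwise with Mathlib's
`mappingCone.inl_v_d`, `d_fst_v`, `d_snd_v`, `id_X` and `ShortComplex.ab_exact_iff_function_exact`.
This is the form consumed by the sheaf-theoretic files, whose section functors are `Ab`-valued
(`AlgebraicGeometry/Modules/QuasiIsoOfAffineSections`).

* `exactAt_iff_function_exact_ab`, `acyclic_iff_forall_function_exact_ab`;
* `mappingCone_exact_of_surj_inj_ab`;
* `quasiIso_of_surj_inj_ab`.

Everything is proved; no named facts. Mathlib searched (pin v4.32): `CochainComplex.mappingCone`,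
`ShortComplex.ab_exact_iff_function_exact`, `HomologicalComplex.exactAt_iff'`; Mathlib has no elementwise
quasi-isomorphism criterion.

## References

* C. A. Weibel, *An introduction to homological algebra*, Cambridge Stud. Adv. Math. 38 (1994), Cor. 1.5.4
  (p. 19: `f` is a quasi-isomorphism iff `cone(f)` is exact). [Weibel1994]
* U. Görtz, T. Wedhorn, *Algebraic Geometry II*, Springer (2023), Rem. F.85. [GortzWedhorn2023]
-/

universe u

open CategoryTheory CategoryTheory.Limits HomologicalComplex CochainComplex

namespace Literature.Algebra.Homology

/-! ### Exactness of complexes of abelian groups in unbundled terms -/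

/-- Exactness of a cochain complex of abelian groups at `j`, in terms of the additive maps
`d : Kⁱ → Kʲ → Kᵏ` (`i + 1 = j`, `j + 1 = k`). [cite: Weibel1994, Def. 1.1.2 (p. 2)] -/
theorem exactAt_iff_function_exact_ab (K : CochainComplex Ab.{u} ℤ) (i j k : ℤ)
    (hij : i + 1 = j) (hjk : j + 1 = k) :
    K.ExactAt j ↔ Function.Exact (K.d i j).hom (K.d j k).hom := by
  rw [K.exactAt_iff' i j k (by simp only [CochainComplex.prev]; omega)
    (by simp only [CochainComplex.next]; omega),
    ShortComplex.ab_exact_iff_function_exact]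
  rfl

/-- A complex of abelian groups is acyclic iff all the pairs `Kⁱ → Kⁱ⁺¹ → Kⁱ⁺²` of consecutive
differentials are exact as additive maps. [cite: Weibel1994, Def. 1.1.2 (p. 2)] -/
theorem acyclic_iff_forall_function_exact_ab (K : CochainComplex Ab.{u} ℤ) :
    K.Acyclic ↔ ∀ i j k : ℤ, i + 1 = j → j + 1 = k →
      Function.Exact (K.d i j).hom (K.d j k).hom := by
  constructor
  · intro h i j k hij hjk
    exact (exactAt_iff_function_exact_ab K i j k hij hjk).1 (h j)
  · intro h j
    exact (exactAt_iff_function_exact_ab K (j - 1) j (j + 1) (by omega) rfl).2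
      (h (j - 1) j (j + 1) (by omega) rfl)

/-! ### The criterion -/

section Criterion

/-- **Elementwise criterion for exactness of the mapping cone** of a morphism `φ : F → C` of
cochain complexes of abelian groups in degree `i₁` (`C(φ)^{i₁} = F^{i₂} ⊕ C^{i₁}`): it suffices that
`H^{i₁}(F) → H^{i₁}(C)` be surjective — every cocycle `z ∈ C^{i₁}` is `φ(x) - dc` for a cocycle
`x ∈ F^{i₁}` — and `H^{i₂}(F) → H^{i₂}(C)` injective — a cocycle `x ∈ F^{i₂}` with `φ(x)` a
coboundary is a coboundary. [cite: Weibel1994, Cor. 1.5.4 (p. 19)] -/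
theorem mappingCone_exact_of_surj_inj_ab {F C : CochainComplex Ab.{u} ℤ} (φ : F ⟶ C) (i₀ i₁ i₂ i₃ : ℤ)
    (h₀₁ : i₀ + 1 = i₁) (h₁₂ : i₁ + 1 = i₂) (h₂₃ : i₂ + 1 = i₃)
    (surj : ∀ z : C.X i₁, (C.d i₁ i₂).hom z = 0 →
      ∃ x : F.X i₁, (F.d i₁ i₂).hom x = 0 ∧ ∃ c : C.X i₀, (φ.f i₁).hom x = z + (C.d i₀ i₁).hom c)
    (inj : ∀ x : F.X i₂, (F.d i₂ i₃).hom x = 0 →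
      (∃ c : C.X i₁, (φ.f i₂).hom x = (C.d i₁ i₂).hom c) →
        ∃ x₁ : F.X i₁, (F.d i₁ i₂).hom x₁ = x) :
    Function.Exact ((mappingCone φ).d i₀ i₁).hom ((mappingCone φ).d i₁ i₂).hom := by
  intro y
  constructor
  · intro hy
    -- the components `x ∈ Fⁱ²`, `c ∈ Cⁱ¹` of the cocycle `y`
    set x : F.X i₂ := ((mappingCone.fst φ).1.v i₁ i₂ h₁₂).hom y with hx_def
    set c : C.X i₁ := ((mappingCone.snd φ).v i₁ i₁ (add_zero i₁)).hom y with hc_def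
    have hx : (F.d i₂ i₃).hom x = 0 := by
      have e := congrArg (fun g : (mappingCone φ).X i₁ ⟶ F.X i₃ => g.hom y)
        (mappingCone.d_fst_v φ i₁ i₂ i₃ h₁₂ h₂₃)
      simp only [AddCommGrpCat.hom_comp, AddMonoidHom.comp_apply, AddCommGrpCat.hom_neg,
        AddMonoidHom.neg_apply] at e
      rw [hy, map_zero] at e
      exact neg_eq_zero.1 e.symm
    have hc : (φ.f i₂).hom x + (C.d i₁ i₂).hom c = 0 := by
      have e := congrArg (fun g : (mappingCone φ).X i₁ ⟶ C.X i₂ => g.hom y)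
        (mappingCone.d_snd_v φ i₁ i₂ h₁₂)
      simp only [AddCommGrpCat.hom_comp, AddMonoidHom.comp_apply, AddCommGrpCat.hom_add,
        AddMonoidHom.add_apply] at e
      rw [hy, map_zero] at e
      exact e.symm
    obtain ⟨x₁, hx₁⟩ := inj x hx ⟨-c, by rw [map_neg]; exact eq_neg_of_add_eq_zero_left hc⟩
    have hz : (C.d i₁ i₂).hom (c + (φ.f i₁).hom x₁) = 0 := by
      have e := congrArg (fun g : F.X i₁ ⟶ C.X i₂ => g.hom x₁) (φ.comm i₁ i₂)
      simp only [AddCommGrpCat.hom_comp, AddMonoidHom.comp_apply] at e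
      rw [map_add, e, hx₁, add_comm, hc]
    obtain ⟨x₂, hx₂, c₂, hc₂⟩ := surj _ hz
    refine ⟨((mappingCone.inl φ).v i₁ i₀ (by omega)).hom (x₂ - x₁) +
      ((mappingCone.inr φ).f i₀).hom (-c₂), ?_⟩
    -- `y = inl x + inr c`
    have hy' : y = ((mappingCone.inl φ).v i₂ i₁ (by omega)).hom x +
        ((mappingCone.inr φ).f i₁).hom c := by
      have e := congrArg (fun g : (mappingCone φ).X i₁ ⟶ (mappingCone φ).X i₁ => g.hom y)
        (mappingCone.id_X φ i₁ i₂ h₁₂)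
      simp only [AddCommGrpCat.hom_comp, AddMonoidHom.comp_apply, AddCommGrpCat.hom_add,
        AddMonoidHom.add_apply, AddCommGrpCat.hom_id, AddMonoidHom.id_apply] at e
      exact e.symm
    have e₁ := congrArg (fun g : F.X i₁ ⟶ (mappingCone φ).X i₁ => g.hom (x₂ - x₁))
      (mappingCone.inl_v_d φ i₁ i₀ i₂ (by omega) (by omega))
    have e₂ := congrArg (fun g : C.X i₀ ⟶ (mappingCone φ).X i₁ => g.hom (-c₂))
      (mappingCone.inr_f_d φ i₀ i₁)
    simp only [AddCommGrpCat.hom_comp, AddMonoidHom.comp_apply, AddCommGrpCat.hom_sub,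
      AddMonoidHom.sub_apply] at e₁ e₂
    rw [map_add, e₁, e₂, hy']
    simp only [map_add, map_sub, map_neg, map_zero, hx₂, hx₁, hc₂]
    abel
  · rintro ⟨w, rfl⟩
    have e := congrArg (fun g : (mappingCone φ).X i₀ ⟶ (mappingCone φ).X i₂ => g.hom w)
      ((mappingCone φ).d_comp_d i₀ i₁ i₂)
    simpa only [AddCommGrpCat.hom_comp, AddMonoidHom.comp_apply, AddCommGrpCat.hom_zero,
      AddMonoidHom.zero_apply] using e

/-- **Elementwise criterion for quasi-isomorphisms of complexes of abelian groups**: `φ : F → C` is a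
quasi-isomorphism as soon as, in every degree, `Hʲ(F) → Hʲ(C)` is surjective and
`Hʲ⁺¹(F) → Hʲ⁺¹(C)` injective in the elementwise sense of `mappingCone_exact_of_surj_inj_ab` (the
cone is then acyclic, `quasiIso_iff_acyclic_mappingCone`). [cite: Weibel1994, Cor. 1.5.4 (p. 19)] -/
theorem quasiIso_of_surj_inj_ab {F C : CochainComplex Ab.{u} ℤ} (φ : F ⟶ C)
    (surj : ∀ (j : ℤ) (z : C.X j), (C.d j (j + 1)).hom z = 0 →
      ∃ x : F.X j, (F.d j (j + 1)).hom x = 0 ∧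
        ∃ c : C.X (j - 1), (φ.f j).hom x = z + (C.d (j - 1) j).hom c)
    (inj : ∀ (j : ℤ) (x : F.X (j + 1)), (F.d (j + 1) (j + 2)).hom x = 0 →
      (∃ c : C.X j, (φ.f (j + 1)).hom x = (C.d j (j + 1)).hom c) →
        ∃ x₁ : F.X j, (F.d j (j + 1)).hom x₁ = x) :
    QuasiIso φ := by
  rw [quasiIso_iff_acyclic_mappingCone, acyclic_iff_forall_function_exact_ab]
  intro i j k hij hjk
  obtain rfl : i = j - 1 := by omega
  subst hjk
  exact mappingCone_exact_of_surj_inj_ab φ (j - 1) j (j + 1) (j + 2) (by omega) rfl (by omega)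
    (surj j) (inj j)

end Criterion

end Literature.Algebra.Homology
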